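import Summits.BirchSwinnertonDyer.BirchSwinnertonDyer.Theorems.ThetaPartnerAtTwoSignedControlAtTwoHOneCoinvObstruction
import Summits.BirchSwinnertonDyer.BirchSwinnertonDyer.Theorems.ThetaPartnerAtTwoSignedControlAtTwoPlusDivOfPrint
import Summits.BirchSwinnertonDyer.Rank1Residual.X11b.CoinvariantsLocal
import Literature.NumberTheory.EllipticCurves.PeriodIndexSupport
import Literature.NumberTheory.EllipticCurves.HasseWeilGoodReduction
import HarnessLib

/-!
# COINV⁺@2 and BOTH conjuncts of K4 for every curve of the row from CASSELS and ONE `H²` statement —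
# Greenberg's Prop. 4.12, the corank count and the dual datum of `H¹(ℚ_Σ/ℚ_∞, E[2^∞])` leave the K4 residue

Route `ThetaPartnerAtTwo` (TP2; crux shared with `ResidualThetaTransportAtTwo`), crux K4 `SignedControlAtTwo`
(stmt-BirchSwinnertonDyer-20309), line `eulerchar` v10 (stub `stub_pubGreenbergPTTwo` = Cassels ∧ Prop. 4.12 ∧ PT(ℚ)).
Seat `prover-bsd-wall-tp2-p3-w2` (width seat 2/3, gen 5), lane «Prop. 4.12 elimination (habitat road)». Part 2.

WHY. COINV⁺@2 (`(Sel⁺(E/ℚ_∞))_γ = 0`) is the step of the signed Γ-Euler-characteristic (EC2) where the line consumes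
Greenberg's `Λ`-adic Prop. 4.12 (`prop412_noFiniteSubmodule_H1Sigma_of_rank_one`, no `_holds`; its proof needs
`H²(ℚ_Σ/ℚ_∞, ·)`, Shapiro for `Hom(Λ, A)`, Lemma 4.11 — none in the tree), the corank count and a finitely generated
dual datum of `H = H¹(ℚ_Σ/ℚ_∞, E[2^∞])`. The chase `signedEndCoinvariants_subsingleton_of_ambient` only needs, for an
ambient `conj_γ`-stable `Hs ⊇ Sel⁺_∞`: (hdiv) every Selmer class is `conj_γ t − t`, `t ∈ Hs`; (hlift) every `t ∈ Hs`
with `conj_γ t − t ∈ Sel⁺_∞` is congruent mod `Sel⁺_∞` to an invariant class. Take `Hs = ⊤ = H¹(ℚ_∞, E[2^∞])`: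
* (hdiv) is part 1 (`HOneCoinv.exists_conjH1_sub_eq_of_resKer_two_injective`): it holds as soon as the restriction
  `H²(Γ_ℚ, E[2^∞]) → H²(Gal(ℚ̄/ℚ_∞), E[2^∞])` is INJECTIVE — the hypothesis `hres` below, displayed, to be discharged
  by parts 3–4 from finite-level Poitou–Tate over `ℚ` (`Ш²`-finiteness, Milne I 4.10(c)/4.16 at the real place);
* (hlift) is §1–§2 here: every class of `H¹(ℚ_∞, E[2^∞])` is unramified outside SOME finite `S₀` (§1, «AEU»: the
  cocycle vanishes on `Gal(ℚ̄/ℚ_∞) ∩ N₁` for an open normal `N₁`, which contains the inertia groups above almost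
  every `v`), and then the landed LIFT assembly `exists_sub_resOfLe_mem_signedSelmerInfty_of_cassels_top` applies
  with THAT `S₀` — CASSELS (`Greenberg1999.casselsSurjectivity_H1Sigma ℚ`, any finite `S₀`), Greenberg p. 108
  (`localQuotient_restriction_surjective_holds`, a theorem) and LOC⁺@2 (`plusLocKummer_two`, a theorem).

WHAT IS PROVED (namespace `…Theorems.SignedEC.ResTwo`):
* §1 `exists_finset_mem_unramifiedOutside` — AEU for every number field `K`, curve `W`, prime `p`, normal `H ≤ Γ_K`:
  each `t ∈ H¹(H, E[p^∞])` lies in `unramifiedOutside H E[p^∞] p S₀` for a finite `S₀` off which (and off `p`) `W`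
  has good reduction.
* §2 `exists_invariant_sub_mem_signedSelmerInfty_two` — (hlift) on ALL of `H¹(ℚ_∞, E[2^∞])` for every globally minimal
  `W/ℚ` with `GoodSS W 2`, `a₂(W) = 0`, `Sel_{2^∞}(W/ℚ)` finite, granted CASSELS by name.
* §3 `signedEndCoinvariants_subsingleton_two_of_cassels_of_resTwo` — COINV⁺@2 ⟸ CASSELS ∧ `hres` ∧ `Sel` finite;
  `signedEulerChar_two_of_cassels_of_resTwo` (EC2), `signedControl_two_allCurves_of_cassels_of_resTwo` (both conjuncts
  of the crux body for every curve of the row) — NO Prop. 4.12, NO `h1Sigma_zpCorank_le_degree`, NO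
  `h1SigmaInfty_rank_eq_one`, NO `finite_dual_H1Sigma`.
HONEST FRAMING: THEOREMS ONLY (no definition, no named fact, no `sorry`); CASSELS is a displayed hypothesis (the
Literature named fact, w3's lane derives it from `poitouTate_selmerStructure_duality`), and so is `hres`; nothing
about any curve is asserted unconditionally; closes no item by itself; BSD is not proved by any of this.

References: [GreenbergLNM1716] §3 Lemma 3.3 (p. 87), §4 Lemma 4.7 (pp. 107–108), Prop. 4.12 (p. 119), Prop. 4.13 /
p. 122; [JetchevSkinnerWan2017] Lemma 3.3.3 (arXiv:1512.06894 pp. 11–12); [BDKim2013] Thm. 3.14, Cor. 3.15;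
[NeukirchANT1999] Ch. II §9 (9.6), Ch. III §2 (2.6); [SilvermanAEC2009] X.4.2–4.4.
-/

set_option autoImplicit false
-- the Theorems namespace of this sub repeats the summit name by design (D-0017 nested layout)
set_option linter.dupNamespace false

noncomputable section

open scoped Classical NumberField

open NumberField IsDedekindDomain Field

namespace Summit.BirchSwinnertonDyer.BirchSwinnertonDyer.Theorems.SignedEC.ResTwo

open Literature.NumberTheory.EllipticCurves Literature.NumberTheory.GaloisRepresentations
  WeierstrassCurve ZpExtension Literature.NumberTheory.EllipticCurves.Kobayashi2003
  Literature.NumberTheory.EllipticCurves.IwasawaDual Literature.NumberTheory.EllipticCurves.IwasawaAlgebra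
  Literature.NumberTheory.EllipticCurves.GreenbergVatsal2000 Literature.NumberTheory.EllipticCurves.GreenbergSelmer
  Literature.NumberTheory.EllipticCurves.Rank1Residual

/-! ## §1 AEU: every class of `H¹(H, E[p^∞])` is unramified outside a finite set of places -/

section AEU

variable {K : Type} [Field K] [NumberField K] (W : WeierstrassCurve K) [W.IsElliptic] (p : ℕ)
  (H : Subgroup (absoluteGaloisGroup K)) [H.Normal]

/-- **AEU — every class of `H¹(H, E[p^∞])` is unramified outside a finite set** (`H ⊴ Γ_K`, e.g.
`H = Gal(K̄/K_∞)`): the cocycle `φ` of `t` vanishes on `H ∩ N₁` for an open normal `N₁ ≤ Γ_K`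
(`X11b.Coinv.exists_openNormalSubgroup_forall_apply_eq_zero`); for all but finitely many finite `v` every inertia
group above `v` lies in `N₁` (`eventually_forall_inertia_le`, Neukirch III (2.6)) and `W` has good reduction
(`eventually_hasGoodReductionAt`); at such `v`, for every `σ`, the conjugate cocycle `h ↦ σ φ(σ⁻¹hσ)` vanishes on
`H ∩ I_v` (`N₁` normal), i.e. `conj_σ t ∈ unramifiedKer H E[p^∞] v`. So `t ∈ H¹(K_Σ/K_∞, E[p^∞]) = unramifiedOutside`
for `Σ = S₀ ∪ {p, ∞}`, `S₀` the finite exceptional set. [cite: GreenbergLNM1716, §3 Lemma 3.3 (p. 87)]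
[cite: NeukirchANT1999, Ch. II §9 Prop. (9.6) and Ch. III §2 Thm. (2.6)] [cite: GreenbergVatsal2000, §2 pp. 16–17] -/
theorem exists_finset_mem_unramifiedOutside (t : W.subgroupH1 p H) :
    ∃ S₀ : Finset (HeightOneSpectrum (𝓞 K)),
      (∀ v : HeightOneSpectrum (𝓞 K), v ∉ S₀ → ((p : ℕ) : 𝓞 K) ∉ v.asIdeal → W.HasGoodReductionAt v) ∧
      t ∈ unramifiedOutside H (W.geomPrimaryTorsion p) p (↑S₀ : Set (HeightOneSpectrum (𝓞 K))) := by
  obtain ⟨φ, rfl⟩ := oneCocycleClass_surjective _ t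
  obtain ⟨N₁, hN₁⟩ :=
    Summit.BirchSwinnertonDyer.Rank1Residual.X11b.Coinv.exists_openNormalSubgroup_forall_apply_eq_zero (K := K) φ
  -- the finite exceptional set: bad places, and places with an inertia group not inside `N₁`
  have hfin : {v : HeightOneSpectrum (𝓞 K) | ¬ W.HasGoodReductionAt v ∨
      ¬ (adicCompletionPrime K v).inertia (absoluteGaloisGroup K) ≤ (N₁ : Subgroup _)}.Finite := by
    have hev := (W.eventually_hasGoodReductionAt (K := K)).and
      (eventually_forall_inertia_le (N₁ : Subgroup (absoluteGaloisGroup K)) N₁.isOpen)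
    refine (Filter.eventually_cofinite.mp hev).subset fun v hv h ↦ ?_
    rcases hv with hbad | hI
    · exact hbad h.1
    · exact hI (h.2 _ (adicCompletionPrime_mem_primesAbove K v))
  refine ⟨hfin.toFinset, fun v hv _ ↦ ?_, ?_⟩
  · by_contra h
    exact hv (hfin.mem_toFinset.mpr (Or.inl h))
  · rw [mem_unramifiedOutside_iff]
    intro v hv _ σ
    have hI : (adicCompletionPrime K v).inertia (absoluteGaloisGroup K) ≤ (N₁ : Subgroup _) := by
      by_contra h
      exact hv (Finset.mem_coe.mpr (hfin.mem_toFinset.mpr (Or.inr h)))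
    change Literature.NumberTheory.EllipticCurves.conjH1 H (W.geomPrimaryTorsion p) σ
        (oneCocycleClass _ φ) ∈ unramifiedKer H (W.geomPrimaryTorsion p) v
    rw [GreenbergVatsal2000.unramifiedKer, AddMonoidHom.mem_ker, conjH1_oneCocycleClass,
      CocycleCriteria.resH1Hom_oneCocycleClass_eq_zero_iff]
    refine ⟨0, fun x ↦ ?_⟩
    rw [smul_zero, sub_zero, AddMonoidHom.id_apply, conjCocycle_apply]
    -- `x ∈ H ∩ I_v`, `I_v ≤ N₁`, `N₁` normal ⇒ `σ⁻¹ x σ ∈ H ∩ N₁`, where `φ` vanishes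
    obtain ⟨-, hxI⟩ := (mem_inertiaIn_iff H v (x : decomp (K := K) v)).mp x.2
    have hxN : ((x : decomp (K := K) v) : absoluteGaloisGroup K) ∈ (N₁ : Subgroup (absoluteGaloisGroup K)) := by
      apply hI
      rw [inertia_adicCompletionPrime_eq_map_absInertia]
      exact hxI
    have hconjN : ((subgroupConj H σ (inertiaInToH H v x) : H) : absoluteGaloisGroup K) ∈
        (N₁ : Subgroup (absoluteGaloisGroup K)) := by
      rw [subgroupConj_apply_coe]
      have h := (inferInstance : (N₁ : Subgroup (absoluteGaloisGroup K)).Normal).conj_mem _ hxN σ⁻¹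
      rwa [inv_inv] at h
    rw [hN₁ _ (subgroupConj H σ (inertiaInToH H v x)).2 hconjN, smul_zero]

end AEU

/-! ## §2 (hlift) on all of `H¹(ℚ_∞, E[2^∞])` from CASSELS, p. 108 and LOC⁺@2 -/

section Two

variable (W : WeierstrassCurve ℚ) [W.IsElliptic] [W.IsGloballyMinimal] (κ : ZpExtension ℚ 2)

/-- **(hlift) for EVERY class of `H¹(ℚ_∞, E[2^∞])`** (globally minimal `W/ℚ`, `GoodSS W 2`, `a₂(W) = 0`, `κ`
cyclotomic with topological generator `γ`, `Sel_{2^∞}(W/ℚ)` finite, CASSELS by name): if `conj_γ t − t ∈ Sel⁺(W/ℚ_∞)`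
then `t − t₀ ∈ Sel⁺(W/ℚ_∞)` for a `conj_γ`-INVARIANT class `t₀` (namely `t₀ = res y`, `y ∈ H¹(ℚ, E[2^∞])`). Proof:
`conj_σ t − t ∈ Sel⁺_∞` for all `σ` (`SSFlatEC.conjH1_sub_mem_of_conjH1_generator_sub_mem`); `t` is unramified
outside a finite `S₀` (§1); the LIFT assembly `exists_sub_resOfLe_mem_signedSelmerInfty_of_cassels_top` with that
`S₀`, CASSELS (any finite `S₀`; `E(ℚ)[2^∞] = 0` at good supersingular `2`), the local lifts at `v ∤ 2` from
Greenberg p. 108 (`localQuotient_restriction_surjective_holds`, `SSFlatEC.exists_localLift_of_localSurj`) and at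
`v ∣ 2` from LOC⁺@2 (`plusLocKummer_two`, `plusLocLayer_of_plusLocKummer`).
[cite: GreenbergLNM1716, §4 Lemma 4.7 (pp. 107–108), p. 104, p. 108, p. 122] [cite: BDKim2013, proof of Cor. 3.15] -/
theorem exists_invariant_sub_mem_signedSelmerInfty_two (hss : GoodSS W 2) (ha : W.frobeniusTrace 2 = 0)
    (hκ : κ.IsCyclotomic) {γ : Field.absoluteGaloisGroup ℚ} (hγ : κ.IsTopGenerator γ)
    (hC : Greenberg1999.casselsSurjectivity_H1Sigma ℚ) (hSel : Finite (W.selmerGroupPInfty 2))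
    (t : W.subgroupH1 2 κ.kerSubgroup)
    (ht : W.conjH1 2 κ.kerSubgroup γ t - t ∈ signedSelmerInfty W κ 1) :
    ∃ t₀ : W.subgroupH1 2 κ.kerSubgroup, W.conjH1 2 κ.kerSubgroup γ t₀ = t₀ ∧ t - t₀ ∈ signedSelmerInfty W κ 1 := by
  -- `E(ℚ)[2] = 0` at good supersingular `2`: `#E(ℚ)[2^∞] = 1` and the `h_n` injective
  have hirr := (Summit.BirchSwinnertonDyer.Rank1Residual.X5.O1.irr_two_iff_forall_two_nsmul W).mp
    (Summit.BirchSwinnertonDyer.Rank1Residual.P2.irr_two_of_goodSS_two W hss)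
  have hE : Nat.card (MulAction.fixedPoints (Field.absoluteGaloisGroup ℚ) (W.geomPrimaryTorsion 2)) = 1 := by
    refine W.natCard_fixedPoints_absoluteGaloisGroup_geomPrimaryTorsion_eq_one (p := 2) fun P hP ↦ ?_
    apply hirr P
    convert hP
  have hinjh : ∀ m, Function.Injective (W.layerToInfty κ m) := fun m ↦ by
    refine Summit.BirchSwinnertonDyer.Rank1Residual.Additive.layerToInfty_injective_of_no_pTorsion W κ
      (fun P hP ↦ ?_) m
    apply hirr P
    convert hP
  -- all conjugates of `t` agree with `t` modulo `Sel⁺_∞`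
  have htall : ∀ σ : Field.absoluteGaloisGroup ℚ, W.conjH1 2 κ.kerSubgroup σ t - t ∈ signedSelmerInfty W κ 1 :=
    SSFlatEC.conjH1_sub_mem_of_conjH1_generator_sub_mem W κ hγ _
      (fun σ s hs ↦ conjH1_mem_signedSelmerInfty W κ 1 σ hs) ht
  -- AEU: `t` is unramified outside a finite `S₀ ⊇` bad places
  obtain ⟨S₀, hgood, htH⟩ := exists_finset_mem_unramifiedOutside W 2 κ.kerSubgroup t
  have hgood' : ∀ w : HeightOneSpectrum (𝓞 ℚ), w ∉ (↑S₀ : Set (HeightOneSpectrum (𝓞 ℚ))) →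
      ((2 : ℕ) : 𝓞 ℚ) ∉ w.asIdeal → W.HasGoodReductionAt w :=
    fun w hw hpw ↦ hgood w (fun h ↦ hw (Finset.mem_coe.mpr h)) hpw
  -- `Sel⁺_∞ ≤ Sel_∞ ≤ 𝒦_w` at every finite `w`
  have hSelle : ∀ w : HeightOneSpectrum (𝓞 ℚ),
      signedSelmerInfty W κ 1 ≤ W.localKerOver 2 κ.kerSubgroup (w.adicCompletion ℚ) := fun w s hs ↦ by
    have h1 := ((W.mem_selmerGroupOver_iff 2 κ.kerSubgroup s).1 (signedSelmerInfty_le_selmerInfty W κ 1 hs)).1 w 1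
    rwa [W.conjH1_one_holds 2 κ.kerSubgroup, AddMonoidHom.id_apply] at h1
  -- the LIFT assembly with this `S₀`
  refine (exists_sub_resOfLe_mem_signedSelmerInfty_of_cassels_top W κ 1 hκ hinjh
    (↑S₀ : Set (HeightOneSpectrum (𝓞 ℚ))) hgood' htH htall
    (fun x xi hx hxi ↦ hC W 2 hSel hE (↑S₀) S₀.finite_toSet hgood' x xi hx hxi) (fun w _ ↦ ?_)).elim
    fun y hy ↦ ⟨W.resOfLe 2 (le_top : κ.kerSubgroup ≤ ⊤) y, SSFlatEC.conjH1_resOfLe_top W κ γ y, hy⟩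
  by_cases h2 : ((2 : ℕ) : 𝓞 ℚ) ∈ w.asIdeal
  · -- `w ∣ 2`: LOC⁺@2 (theorem) in the level-`∞` Kummer form, then the layer form
    obtain ⟨xw, hx, hmain⟩ := plusLocKummer_two W hss ha hκ t htall w h2
    refine ⟨xw, hx, fun y hy ↦ ?_⟩
    obtain ⟨hker, hlayer⟩ := plusLocLayer_of_plusLocKummer W κ 1 hss h2 (hmain y hy)
    exact ⟨hker, fun _ ↦ hlayer⟩
  · -- `w ∤ 2`: Greenberg p. 108 (theorem `localQuotient_restriction_surjective_holds`)
    obtain ⟨xw, hx, hmain⟩ := SSFlatEC.exists_localLift_of_localSurj W κ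
      (Greenberg1999.localQuotient_restriction_surjective_holds W 2 κ hκ w h2) _ (hSelle w) t htall
    exact ⟨xw, hx, fun y hy ↦ ⟨hmain y hy, fun hw2 ↦ absurd (by exact_mod_cast hw2) h2⟩⟩

/-! ## §3 COINV⁺@2, EC2 and both conjuncts of K4 from CASSELS and `res : H²(ℚ, E[2^∞]) ↪ H²(ℚ_∞, E[2^∞])` -/

/-- **COINV⁺@2 from CASSELS and the injectivity of `res : H²(Γ_ℚ, E[2^∞]) → H²(Gal(ℚ̄/ℚ_∞), E[2^∞])`**
(globally minimal `W/ℚ`, `GoodSS W 2`, `a₂(W) = 0`, cyclotomic `κ`, topological generator `γ`, `Sel_{2^∞}(W/ℚ)`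
finite): `(Sel⁺(W/ℚ_∞))_γ = 0` — the chase `signedEndCoinvariants_subsingleton_of_ambient` with ambient group ALL of
`H¹(ℚ_∞, E[2^∞])`, (hdiv) from part 1 and `hres`, (hlift) from §2. No Prop. 4.12, no corank count, no dual datum.
[cite: GreenbergLNM1716, §4 pp. 104, 107–109, 119, 122] [cite: JetchevSkinnerWan2017, Lemma 3.3.3 (arXiv:1512.06894 pp. 11–12)]
[cite: BDKim2013, Thm. 3.14 and proof of Cor. 3.15] -/
theorem signedEndCoinvariants_subsingleton_two_of_cassels_of_resTwo (hss : GoodSS W 2) (ha : W.frobeniusTrace 2 = 0)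
    (hκ : κ.IsCyclotomic) {γ : Field.absoluteGaloisGroup ℚ} (hγ : κ.IsTopGenerator γ)
    (hC : Greenberg1999.casselsSurjectivity_H1Sigma ℚ)
    (hres : ∀ c : galoisCohomology (Summit.BirchSwinnertonDyer.Rank1Residual.X11b.LocBridge.primaryGaloisModule W 2) 2,
      resSubgroup (Summit.BirchSwinnertonDyer.Rank1Residual.X11b.LocBridge.primaryGaloisModule W 2).toTopRep
        κ.kerSubgroup 2 c = 0 → c = 0)
    (hSel : Finite (W.selmerGroupPInfty 2)) :
    Subsingleton (EndCoinvariants (conjSignedSelmerInfty W κ 1 γ - 1)) :=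
  signedEndCoinvariants_subsingleton_of_ambient W κ 1 γ ⊤
    (fun s _ ↦ by
      obtain ⟨t, ht⟩ := HOneCoinv.exists_conjH1_sub_eq_of_resKer_two_injective W 2 κ hres hγ s
      exact ⟨t, AddSubgroup.mem_top t, ht⟩)
    (fun t _ ht ↦ exists_invariant_sub_mem_signedSelmerInfty_two W κ hss ha hκ hγ hC hSel t ht)

/-- **COINV⁺@2 in `Nat.card` form** (the `hcoinv` binder of `signedEulerChar_two_of_localInj_of_cassels_of_coinv`).
[cite: GreenbergLNM1716, §4 p. 104, Prop. 4.13] -/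
theorem natCard_signedEndCoinvariants_two_eq_one_of_cassels_of_resTwo (hss : GoodSS W 2)
    (ha : W.frobeniusTrace 2 = 0) (hκ : κ.IsCyclotomic) {γ : Field.absoluteGaloisGroup ℚ} (hγ : κ.IsTopGenerator γ)
    (hC : Greenberg1999.casselsSurjectivity_H1Sigma ℚ)
    (hres : ∀ c : galoisCohomology (Summit.BirchSwinnertonDyer.Rank1Residual.X11b.LocBridge.primaryGaloisModule W 2) 2,
      resSubgroup (Summit.BirchSwinnertonDyer.Rank1Residual.X11b.LocBridge.primaryGaloisModule W 2).toTopRep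
        κ.kerSubgroup 2 c = 0 → c = 0)
    (hSel : Finite (W.selmerGroupPInfty 2)) :
    Nat.card (EndCoinvariants (conjSignedSelmerInfty W κ 1 γ - 1)) = 1 := by
  haveI := signedEndCoinvariants_subsingleton_two_of_cassels_of_resTwo W κ hss ha hκ hγ hC hres hSel
  exact Nat.card_unique

/-- **EC2 for EVERY curve of the row from CASSELS and `hres`** (no Prop. 4.12, no corank count, no weak Leopoldt):
`Sel⁺(W/ℚ_∞)^γ` is finite and `#Sel⁺_∞^γ = u·2^{v₂∏c_ℓ}·#Sel_{2^∞}(W/ℚ)·#(Sel⁺_∞)_γ` — the landed EC2 assembly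
`signedEulerChar_two_of_localInj_of_cassels_of_coinv` with INJ⁺@2 (`plusLocalInj_two_of_cyclicModTwo` ∘ LEV0@2 ∘ CYC⁺@2,
theorems), Cassels' count (`signedCasselsCountTwo_of_localInj_of_casselsSurjectivity`) and COINV⁺@2 above.
[cite: BDKim2013, Cor. 3.15 (p. 199)] [cite: GreenbergLNM1716, §4 Lemma 4.7, Prop. 4.13, pp. 119–122] -/
theorem signedEulerChar_two_of_cassels_of_resTwo (hss : GoodSS W 2) (ha : W.frobeniusTrace 2 = 0)
    (hκ : κ.IsCyclotomic) {γ : Field.absoluteGaloisGroup ℚ} (hγ : κ.IsTopGenerator γ)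
    (hC : Greenberg1999.casselsSurjectivity_H1Sigma ℚ)
    (hres : ∀ c : galoisCohomology (Summit.BirchSwinnertonDyer.Rank1Residual.X11b.LocBridge.primaryGaloisModule W 2) 2,
      resSubgroup (Summit.BirchSwinnertonDyer.Rank1Residual.X11b.LocBridge.primaryGaloisModule W 2).toTopRep
        κ.kerSubgroup 2 c = 0 → c = 0)
    (hSel : Finite (W.selmerGroupPInfty 2)) :
    Finite (endInvariants (conjSignedSelmerInfty W κ 1 γ - 1)) ∧
      ∃ u : ℤ_[2]ˣ, (Nat.card (endInvariants (conjSignedSelmerInfty W κ 1 γ - 1)) : ℚ_[2]) =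
        ((u : ℤ_[2]) : ℚ_[2]) * ((2 : ℕ) : ℚ_[2]) ^ (padicValNat 2 W.tamagawaProduct) *
          (Nat.card (W.selmerGroupPInfty 2) : ℚ_[2]) *
            (Nat.card (EndCoinvariants (conjSignedSelmerInfty W κ 1 γ - 1)) : ℚ_[2]) := by
  have hinj : ∀ v : HeightOneSpectrum (𝓞 ℚ), (2 : 𝓞 ℚ) ∈ v.asIdeal →
      ∀ y ∈ (signedSelmerInfty W κ 1).comap (W.layerToInfty κ 0),
        W.localResOver 2 (κ.layerSubgroup 0) (v.adicCompletion ℚ) y = 0 := fun v hv ↦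
    plusLocalInj_two_of_cyclicModTwo W hss κ v hv (exists_mem_localLayerPointsOfEmb_zero_ne_two_nsmul W κ v hv)
      (fun n ↦ plusCyclicLayers_two W hss ha hκ v hv n)
  exact signedEulerChar_two_of_localInj_of_cassels_of_coinv W hss κ hγ hinj
    (signedCasselsCountTwo_of_localInj_of_casselsSurjectivity W hC hss hκ hinj)
    (fun hSel' _ ↦ natCard_signedEndCoinvariants_two_eq_one_of_cassels_of_resTwo W κ hss ha hκ hγ hC hres hSel')
    hSel

/-- **Both conjuncts of crux K4 `SignedControlAtTwo` for EVERY curve of the row, from CASSELS and `hres`** (the crux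
body with the idle binders `¬ W.HasCM`, `W.analyticRank = 0` dropped): (i) `X⁺(W/ℚ_∞)` is finitely generated over
`Λ` (`SignedSelmerDualData.moduleFinite`); (ii) for `X⁺` torsion with `Char = (g)` and `Sel_{2^∞}(W/ℚ)` finite,
`g(0) ∼ 2^{v₂∏c_ℓ}·#Sel_{2^∞}(W/ℚ)` (`kimControl_at_of_signedEulerCharTwo` ∘ EC2 above). `hres` is asked for every
CYCLOTOMIC `κ`. [cite: BDKim2013, Cor. 3.15] [cite: Kobayashi2003, Thm. 1.2] [cite: GreenbergLNM1716, §4 Lemma 4.2, Prop. 4.13] -/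
theorem signedControl_two_allCurves_of_cassels_of_resTwo (hC : Greenberg1999.casselsSurjectivity_H1Sigma ℚ)
    (hres : ∀ κ : ZpExtension ℚ 2, κ.IsCyclotomic →
      ∀ c : galoisCohomology (Summit.BirchSwinnertonDyer.Rank1Residual.X11b.LocBridge.primaryGaloisModule W 2) 2,
        resSubgroup (Summit.BirchSwinnertonDyer.Rank1Residual.X11b.LocBridge.primaryGaloisModule W 2).toTopRep
          κ.kerSubgroup 2 c = 0 → c = 0)
    (hss : GoodSS W 2) (ha : W.frobeniusTrace 2 = 0) :
    (∀ (κ : ZpExtension ℚ 2) (γ : Field.absoluteGaloisGroup ℚ), κ.IsCyclotomic → κ.IsTopGenerator γ →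
        ∀ D : SignedSelmerDualData W κ γ 1, Module.Finite (IwasawaAlgebra 2) D.X) ∧
      (∀ (κ : ZpExtension ℚ 2) (γ : Field.absoluteGaloisGroup ℚ), κ.IsCyclotomic → κ.IsTopGenerator γ →
        ∀ (D : SignedSelmerDualData W κ γ 1) [Module.Finite (IwasawaAlgebra 2) D.X],
          Module.IsTorsion (IwasawaAlgebra 2) D.X → ∀ g : IwasawaAlgebra 2, D.charIdeal = Ideal.span {g} →
          Finite (W.selmerGroupPInfty 2) →
          ∃ u : ℤ_[2]ˣ, ((PowerSeries.constantCoeff g : ℤ_[2]) : ℚ_[2]) =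
            ((u : ℤ_[2]) : ℚ_[2]) * ((2 : ℕ) : ℚ_[2]) ^ (padicValNat 2 W.tamagawaProduct) *
              (Nat.card (W.selmerGroupPInfty 2) : ℚ_[2])) :=
  ⟨fun _ _ _ hγ D ↦ SignedSelmerDualData.moduleFinite hγ D,
    kimControl_at_of_signedEulerCharTwo fun κ _ hκ hγ hSel ↦
      signedEulerChar_two_of_cassels_of_resTwo W κ hss ha hκ hγ hC (hres κ hκ) hSel⟩

end Two

end Summit.BirchSwinnertonDyer.BirchSwinnertonDyer.Theorems.SignedEC.ResTwo

end
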